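import Mathlib
import HarnessLib
import Literature.NumberTheory.LFunctions.CriticalLineTwoThirds

/-!
# RH-FREE — Alpöge–Furman 2026, Lemma 3.2 (the rank–trace inequality): DISCHARGED

Topic `Literature/NumberTheory/LFunctions` (namespace `Literature.NumberTheory.LFunctions`; helper
lemmas in the sub-namespace `AlpogeFurman2026.RankTrace`). PROOF LAYER for the statement file
`CriticalLineTwoThirds.lean`: the named fact

* `AlpogeFurman2026_rank_trace` — [AF26] Lemma 3.2 (p. 5): for Hermitian `d × d` matrices
  `P ⪰ 0`, `Q` with `rank P ≤ r` and `n₊(Q) ≤ b`,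
  `2 tr P + 4 tr Q − 4b − ‖P + Q‖²_HS ≤ r` (`‖R‖²_HS = tr R²`, `n₊ = posEigenvalueCount`)

is proved here as `AlpogeFurman2026_rank_trace_holds : AlpogeFurman2026_rank_trace`, sorry-free,
from Mathlib's spectral theorem for Hermitian matrices (`Matrix.IsHermitian.spectral_theorem`).
This is the finite-dimensional engine of the [AF26] certificate
`N₀ˢ + o(N) ≥ 4 tr G̃ − 2N − ‖G̃‖²_HS` (chain (1.2)); nothing here bears on the analytic inputs
(Z), (P) of that paper, and nothing here bears on the truth of RH.

## The proof given here (NOT the printed one)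

[AF26] prove Lemma 3.2 via the decomposition `Q = Q₊ − Q₋` and von Neumann's trace inequality
(resp. Remark 3.3: a compactness argument on `U(d)`); neither is in Mathlib. We give an
eigenvalue-pairing-free argument that needs only conjugated diagonal matrices:

* write `Q = Q₊ − Q₋` with `Q± = U diag(λ±) U*` (`U` = `hQ.eigenvectorUnitary`, `λ± = max(±λ, 0)`),
  so `Q₊ Q₋ = 0`, `Q± ⪰ 0`, `tr Q₊² = Σ (λᵢ⁺)²`, `tr Q₊ = Σ λᵢ⁺`, `n₊(Q) = #{λᵢ > 0}`;
* write `Π = V diag(𝟙[νᵢ ≠ 0]) V*` (`V` = eigenvector unitary of `P`, `ν` its eigenvalues), a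
  Hermitian idempotent with `P Π = P` and `tr Π = rank P ≤ r`
  (`Matrix.IsHermitian.rank_eq_card_non_zero_eigs`);
* then `tr (P+Q)² = tr (P − Q₋)² + 2 tr(P Q₊) + tr Q₊²` (because `Q₋ Q₊ = 0`), and
  (i) `tr(P Q₊) = tr(Q₊^{½} P Q₊^{½}) ≥ 0`;
  (ii) `tr Q₊² − 4 tr Q₊ + 4 n₊(Q) = Σᵢ ((λᵢ⁺)² − 4λᵢ⁺ + 4·𝟙[λᵢ>0]) ≥ 0` termwise
  (`(λ − 2)² ≥ 0`);
  (iii) `tr (P − Q₋)² − 2 tr P + tr Π + 4 tr Q₋ = tr (P − Q₋ − Π)² + 2 tr Q₋ + 2 tr((1 − Π) Q₋ (1 − Π)) ≥ 0`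
  (using `P Π = P`, `Π² = Π`).
  Adding (i)–(iii) gives `tr (P+Q)² ≥ 2 tr P + 4 tr Q − 4b − r`.

All traces are read through `Complex.re`, as in the statement; non-negativity of traces of
positive semidefinite matrices is Mathlib's `Matrix.PosSemidef.trace_nonneg` (order on `ℂ` =
`ComplexOrder`).

## References

* [AF26] L. Alpöge, R. Furman, *More than two thirds of the zeros of the Riemann zeta function
  are simple and on the critical line*, arXiv:2608.13637v2 (2026), Lemma 3.2 and Remark 3.3
  (p. 5–6). [key `AlpogeFurman2026`]
-/

open Matrix Complex Finset
open scoped ComplexOrder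

namespace Literature.NumberTheory.LFunctions

namespace AlpogeFurman2026.RankTrace

variable {n : Type*} [Fintype n]

section Diagonal

variable [DecidableEq n]

/-! ### Conjugated diagonal matrices `U · diag f · U*` with `U* U = 1` -/

/-- Product of two conjugated diagonals. [folklore] -/
private theorem conj_diagonal_mul (U : Matrix n n ℂ) (hU : star U * U = 1) (f g : n → ℂ) :
    U * diagonal f * star U * (U * diagonal g * star U) =
      U * diagonal (fun i ↦ f i * g i) * star U := by
  have : U * diagonal f * star U * (U * diagonal g * star U) =
      U * diagonal f * (star U * U) * diagonal g * star U := by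
    simp only [Matrix.mul_assoc]
  rw [this, hU, Matrix.mul_one, Matrix.mul_assoc U (diagonal f), diagonal_mul_diagonal]

/-- Difference of two conjugated diagonals. [folklore] -/
private theorem conj_diagonal_sub (U : Matrix n n ℂ) (f g : n → ℂ) :
    U * diagonal f * star U - U * diagonal g * star U =
      U * diagonal (fun i ↦ f i - g i) * star U := by
  rw [← Matrix.sub_mul, ← Matrix.mul_sub, diagonal_sub]

/-- Trace of a conjugated diagonal. [folklore] -/
private theorem trace_conj_diagonal (U : Matrix n n ℂ) (hU : star U * U = 1) (f : n → ℂ) :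
    (U * diagonal f * star U).trace = ∑ i, f i := by
  rw [Matrix.trace_mul_comm, ← Matrix.mul_assoc, hU, Matrix.one_mul, trace_diagonal]

/-- Real part of the trace of a conjugated REAL diagonal. [folklore] -/
private theorem re_trace_conj_diagonal (U : Matrix n n ℂ) (hU : star U * U = 1) (x : n → ℝ) :
    (U * diagonal (fun i ↦ (x i : ℂ)) * star U).trace.re = ∑ i, x i := by
  rw [trace_conj_diagonal U hU, Complex.re_sum]
  simp

/-- A conjugated real diagonal is Hermitian. [folklore] -/
private theorem isHermitian_conj_diagonal (U : Matrix n n ℂ) (x : n → ℝ) :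
    (U * diagonal (fun i ↦ (x i : ℂ)) * star U).IsHermitian := by
  rw [Matrix.star_eq_conjTranspose]
  refine isHermitian_mul_mul_conjTranspose _ ?_
  exact isHermitian_diagonal_iff.2 fun i ↦ by simp [IsSelfAdjoint, Complex.conj_ofReal]

/-- A conjugated non-negative real diagonal is positive semidefinite. [folklore] -/
private theorem posSemidef_conj_diagonal (U : Matrix n n ℂ) (x : n → ℝ) (hx : ∀ i, 0 ≤ x i) :
    (U * diagonal (fun i ↦ (x i : ℂ)) * star U).PosSemidef := by
  rw [Matrix.star_eq_conjTranspose]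
  exact (posSemidef_diagonal_iff.2 fun i ↦ Complex.zero_le_real.2 (hx i)).mul_mul_conjTranspose_same U

end Diagonal

/-! ### Traces: real parts, non-negativity, expansions -/

/-- `Re tr A ≥ 0` for `A ⪰ 0`. [folklore] -/
private theorem re_trace_nonneg {A : Matrix n n ℂ} (hA : A.PosSemidef) : 0 ≤ A.trace.re := by
  have h := (Complex.le_def.1 hA.trace_nonneg).1
  simpa using h

/-- `Re tr X² ≥ 0` for Hermitian `X` (`X² = Xᴴ X ⪰ 0`). [folklore] -/
private theorem re_trace_mul_self_nonneg {X : Matrix n n ℂ} (hX : X.IsHermitian) :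
    0 ≤ ((X * X).trace).re := by
  have h := posSemidef_conjTranspose_mul_self X
  rw [hX.eq] at h
  exact re_trace_nonneg h

/-- `tr (A + B)² = tr A² + 2 tr(AB) + tr B²`. [folklore] -/
private theorem trace_add_mul_add (A B : Matrix n n ℂ) :
    ((A + B) * (A + B)).trace = (A * A).trace + 2 * (A * B).trace + (B * B).trace := by
  rw [Matrix.add_mul, Matrix.mul_add, Matrix.mul_add, trace_add, trace_add, trace_add,
    Matrix.trace_mul_comm B A]
  ring

/-- `tr (A − B)² = tr A² − 2 tr(AB) + tr B²`. [folklore] -/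
private theorem trace_sub_mul_sub (A B : Matrix n n ℂ) :
    ((A - B) * (A - B)).trace = (A * A).trace - 2 * (A * B).trace + (B * B).trace := by
  rw [Matrix.sub_mul, Matrix.mul_sub, Matrix.mul_sub, trace_sub, trace_sub, trace_sub,
    Matrix.trace_mul_comm B A]
  ring

/-- `Re tr(P N) ≥ 0` for `P ⪰ 0` and `N = H²` with `H` Hermitian (`tr(P H H) = tr(H P Hᴴ)`).
[folklore] -/
private theorem re_trace_mul_sq_nonneg {P H : Matrix n n ℂ} (hP : P.PosSemidef) (hH : H.IsHermitian) :
    0 ≤ ((P * (H * H)).trace).re := by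
  have h1 : (P * (H * H)).trace = (H * P * Hᴴ).trace := by
    rw [← Matrix.mul_assoc, Matrix.trace_mul_comm, ← Matrix.mul_assoc, hH.eq]
  rw [h1]
  exact re_trace_nonneg (hP.mul_mul_conjTranspose_same H)

/-- For a Hermitian idempotent `E` and `N ⪰ 0`: `Re tr(N E) ≤ Re tr N`
(`tr N − tr(N E) = tr((1 − E) N (1 − E)ᴴ) ≥ 0`). [folklore] -/
private theorem re_trace_mul_proj_le [DecidableEq n] {N E : Matrix n n ℂ} (hN : N.PosSemidef)
    (hE : E.IsHermitian) (hE2 : E * E = E) : ((N * E).trace).re ≤ (N.trace).re := by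
  have hc : (1 - E) * (1 - E) = 1 - E := by
    rw [Matrix.sub_mul, Matrix.mul_sub, Matrix.mul_sub, Matrix.one_mul, Matrix.mul_one,
      Matrix.one_mul, hE2]
    abel
  have hh : (1 - E : Matrix n n ℂ).IsHermitian := Matrix.isHermitian_one.sub hE
  have h1 : ((1 - E) * N * (1 - E)ᴴ).trace = N.trace - (N * E).trace := by
    rw [hh.eq, Matrix.trace_mul_comm, ← Matrix.mul_assoc, hc, Matrix.sub_mul, Matrix.one_mul,
      trace_sub, Matrix.trace_mul_comm E N]
  have h2 := re_trace_nonneg (hN.mul_mul_conjTranspose_same (1 - E))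
  rw [h1, Complex.sub_re] at h2
  linarith

end AlpogeFurman2026.RankTrace

open AlpogeFurman2026.RankTrace in
/-- **[AF26] Lemma 3.2 (rank–trace inequality), PROVED**: for Hermitian `d × d` complex matrices
`P ⪰ 0` and `Q`, with `rank P ≤ r` and `n₊(Q) ≤ b` (`n₊ = posEigenvalueCount`, the number of
strictly positive eigenvalues), `2 tr P + 4 tr Q − 4b − tr (P+Q)² ≤ r` (traces through `re`).
Discharges the named fact `AlpogeFurman2026_rank_trace` of `CriticalLineTwoThirds.lean`; the
argument (module docstring) replaces von Neumann's trace inequality of the printed proof by three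
sum-of-squares identities. [cite: AlpogeFurman2026, Lemma 3.2 (p. 5)] -/
theorem AlpogeFurman2026_rank_trace_holds : AlpogeFurman2026_rank_trace := by
  intro d P Q hP hQ r b hr hb
  -- Spectral data of `Q`
  set U : Matrix (Fin d) (Fin d) ℂ := (hQ.eigenvectorUnitary : Matrix (Fin d) (Fin d) ℂ) with hUdef
  have hU : star U * U = 1 := Unitary.star_mul_self_of_mem hQ.eigenvectorUnitary.prop
  set μ : Fin d → ℝ := hQ.eigenvalues with hμdef
  have hQspec : Q = U * diagonal (fun i ↦ ((μ i : ℝ) : ℂ)) * star U := by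
    have h := hQ.spectral_theorem
    rw [Unitary.conjStarAlgAut_apply] at h
    exact h
  -- Spectral data of `P`
  have hPh : P.IsHermitian := hP.1
  set V : Matrix (Fin d) (Fin d) ℂ := (hPh.eigenvectorUnitary : Matrix (Fin d) (Fin d) ℂ) with hVdef
  have hV : star V * V = 1 := Unitary.star_mul_self_of_mem hPh.eigenvectorUnitary.prop
  set ν : Fin d → ℝ := hPh.eigenvalues with hνdef
  have hPspec : P = V * diagonal (fun i ↦ ((ν i : ℝ) : ℂ)) * star V := by
    have h := hPh.spectral_theorem
    rw [Unitary.conjStarAlgAut_apply] at h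
    exact h
  -- The pieces `Q₊`, `Q₋`, `Q₊^{1/2}`, and the range projection `Π` of `P`
  set fp : Fin d → ℝ := fun i ↦ max (μ i) 0 with hfpdef
  set fm : Fin d → ℝ := fun i ↦ max (-μ i) 0 with hfmdef
  set Qp : Matrix (Fin d) (Fin d) ℂ := U * diagonal (fun i ↦ ((fp i : ℝ) : ℂ)) * star U with hQpdef
  set Qm : Matrix (Fin d) (Fin d) ℂ := U * diagonal (fun i ↦ ((fm i : ℝ) : ℂ)) * star U with hQmdef
  set Qh : Matrix (Fin d) (Fin d) ℂ :=
    U * diagonal (fun i ↦ ((Real.sqrt (fp i) : ℝ) : ℂ)) * star U with hQhdef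
  set ind : Fin d → ℝ := fun i ↦ if ν i = 0 then 0 else 1 with hinddef
  set Pr : Matrix (Fin d) (Fin d) ℂ := V * diagonal (fun i ↦ ((ind i : ℝ) : ℂ)) * star V with hPrdef
  have hfp0 : ∀ i, 0 ≤ fp i := fun i ↦ le_max_right _ _
  have hfm0 : ∀ i, 0 ≤ fm i := fun i ↦ le_max_right _ _
  -- scalar identities on the eigenvalues of `Q`
  have hpm : ∀ i, fp i - fm i = μ i := fun i ↦ max_zero_sub_max_neg_zero_eq_self (μ i)
  have hpm0 : ∀ i, fm i * fp i = 0 := fun i ↦ by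
    rcases le_total 0 (μ i) with h | h
    · simp [hfmdef, h]
    · simp [hfpdef, h]
  -- matrix identities
  have hQdec : Q = Qp - Qm := by
    have hfun : (fun i ↦ ((fp i : ℝ) : ℂ) - ((fm i : ℝ) : ℂ)) = fun i ↦ ((μ i : ℝ) : ℂ) := by
      funext i; rw [← Complex.ofReal_sub, hpm]
    rw [hQpdef, hQmdef, conj_diagonal_sub, hfun, hQspec]
  have hQmQp : Qm * Qp = 0 := by
    rw [hQmdef, hQpdef, conj_diagonal_mul U hU]
    have : (fun i ↦ ((fm i : ℝ) : ℂ) * ((fp i : ℝ) : ℂ)) = fun _ ↦ 0 := by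
      funext i; rw [← Complex.ofReal_mul, hpm0 i, Complex.ofReal_zero]
    rw [this]
    simp
  have hQhQh : Qh * Qh = Qp := by
    have hfun : (fun i ↦ ((Real.sqrt (fp i) : ℝ) : ℂ) * ((Real.sqrt (fp i) : ℝ) : ℂ)) =
        fun i ↦ ((fp i : ℝ) : ℂ) := by
      funext i; rw [← Complex.ofReal_mul, Real.mul_self_sqrt (hfp0 i)]
    rw [hQhdef, hQpdef, conj_diagonal_mul U hU, hfun]
  have hQh : Qh.IsHermitian := isHermitian_conj_diagonal U _
  have hQmpsd : Qm.PosSemidef := posSemidef_conj_diagonal U fm hfm0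
  have hQmh : Qm.IsHermitian := hQmpsd.1
  have hPrh : Pr.IsHermitian := isHermitian_conj_diagonal V _
  have hind2 : ∀ i, ind i * ind i = ind i := fun i ↦ by
    simp only [hinddef]
    split_ifs <;> simp
  have hPrPr : Pr * Pr = Pr := by
    have hfun : (fun i ↦ ((ind i : ℝ) : ℂ) * ((ind i : ℝ) : ℂ)) = fun i ↦ ((ind i : ℝ) : ℂ) := by
      funext i; rw [← Complex.ofReal_mul, hind2]
    rw [hPrdef, conj_diagonal_mul V hV, hfun]
  have hνind : ∀ i, ν i * ind i = ν i := fun i ↦ by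
    simp only [hinddef]
    split_ifs with h <;> simp [h]
  have hPPr : P * Pr = P := by
    have hfun : (fun i ↦ ((ν i : ℝ) : ℂ) * ((ind i : ℝ) : ℂ)) = fun i ↦ ((ν i : ℝ) : ℂ) := by
      funext i; rw [← Complex.ofReal_mul, hνind]
    rw [hPrdef, hPspec, conj_diagonal_mul V hV, hfun]
  -- traces
  have htrPr : (Pr.trace).re = (P.rank : ℝ) := by
    rw [hPrdef, re_trace_conj_diagonal V hV, hPh.rank_eq_card_non_zero_eigs, Fintype.card_subtype,
      Finset.card_filter]
    push_cast
    refine Finset.sum_congr rfl fun i _ ↦ ?_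
    simp only [hinddef, hνdef]
    by_cases h : hPh.eigenvalues i = 0 <;> simp [h]
  have htrQp : (Qp.trace).re = ∑ i, fp i := re_trace_conj_diagonal U hU fp
  have htrQm : (Qm.trace).re = ∑ i, fm i := re_trace_conj_diagonal U hU fm
  have htrQ : (Q.trace).re = ∑ i, fp i - ∑ i, fm i := by
    rw [hQdec, trace_sub, Complex.sub_re, htrQp, htrQm]
  have htrQp2 : ((Qp * Qp).trace).re = ∑ i, fp i ^ 2 := by
    rw [hQpdef, conj_diagonal_mul U hU]
    have : (fun i ↦ ((fp i : ℝ) : ℂ) * ((fp i : ℝ) : ℂ)) = fun i ↦ ((fp i ^ 2 : ℝ) : ℂ) := by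
      funext i; push_cast; ring
    rw [this, re_trace_conj_diagonal U hU]
  have hposc : (posEigenvalueCount hQ : ℝ) = ∑ i, (if 0 < μ i then (1 : ℝ) else 0) := by
    rw [posEigenvalueCount, Finset.card_filter]
    push_cast
    rfl
  -- (ii) the scalar inequality `Σ (λ⁺)² ≥ 4 Σ λ⁺ − 4 n₊`
  have hii : 4 * ∑ i, fp i - 4 * (posEigenvalueCount hQ : ℝ) ≤ ∑ i, fp i ^ 2 := by
    rw [hposc, Finset.mul_sum, Finset.mul_sum, ← Finset.sum_sub_distrib]
    refine Finset.sum_le_sum fun i _ ↦ ?_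
    simp only [hfpdef]
    split_ifs with h
    · rw [max_eq_left h.le]; nlinarith [sq_nonneg (μ i - 2)]
    · rw [max_eq_right (not_lt.1 h)]; norm_num
  -- (i) `Re tr(P Q₊) ≥ 0`
  have hi : 0 ≤ ((P * Qp).trace).re := by
    rw [← hQhQh]
    exact re_trace_mul_sq_nonneg hP hQh
  -- (iii) the `P`-part: `Re tr (P − Q₋)² ≥ 2 Re tr P − r − 4 Re tr Q₋`
  have hiii : 2 * (P.trace).re - (r : ℝ) - 4 * (Qm.trace).re ≤ (((P - Qm) * (P - Qm)).trace).re := by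
    have hX : (P - Qm - Pr).IsHermitian := (hPh.sub hQmh).sub hPrh
    have h0 := re_trace_mul_self_nonneg hX
    have hexp : ((P - Qm - Pr) * (P - Qm - Pr)).trace =
        ((P - Qm) * (P - Qm)).trace - 2 * (P.trace - (Qm * Pr).trace) + Pr.trace := by
      rw [trace_sub_mul_sub, hPrPr, Matrix.sub_mul P Qm Pr, trace_sub, hPPr]
    rw [hexp] at h0
    simp only [Complex.sub_re, Complex.add_re, Complex.mul_re, Complex.re_ofNat,
      Complex.im_ofNat, zero_mul, sub_zero] at h0
    have h1 := re_trace_mul_proj_le hQmpsd hPrh hPrPr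
    have h2 := re_trace_nonneg hQmpsd
    have h3 : (P.rank : ℝ) ≤ r := by exact_mod_cast hr
    rw [htrPr] at h0
    linarith
  -- assembly: `tr (P+Q)² = tr (P−Q₋)² + 2 tr(P Q₊) + tr Q₊²`
  have hsum : ((P + Q) * (P + Q)).trace =
      ((P - Qm) * (P - Qm)).trace + 2 * (P * Qp).trace + (Qp * Qp).trace := by
    rw [hQdec, show P + (Qp - Qm) = (P - Qm) + Qp by abel, trace_add_mul_add,
      Matrix.sub_mul P Qm Qp, trace_sub, hQmQp, trace_zero, sub_zero]
  have hsum' : (((P + Q) * (P + Q)).trace).re =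
      (((P - Qm) * (P - Qm)).trace).re + 2 * ((P * Qp).trace).re + ((Qp * Qp).trace).re := by
    rw [hsum]
    simp
  have hb' : (posEigenvalueCount hQ : ℝ) ≤ b := by exact_mod_cast hb
  rw [hsum', htrQ, htrQp2]
  rw [htrQm] at hiii
  linarith

end Literature.NumberTheory.LFunctions


/-!
## [AF26] Lemma 5.6, second value: the Montgomery–Taylor window constant `R(ψ_MT) = ½ + (1/√2) cot(1/√2)` — DISCHARGED

(Appended by cell `rh-columns/lit`, tranche 1; RH-FREE — nothing here bears on the truth of RH.)
Discharges the claim `AlpogeFurman2026_windowConstant_MT` of `CriticalLineTwoThirds.lean` ([AF26]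
Lemma 5.6, p. 11): for `ψ_MT(s) = cos(√2 s)` on `[−½,½]`,
`R(ψ_MT) = (∫ψ² + ∫∫|u − v|ψ(u)ψ(v))/(∫ψ)² = ½ + (1/√2) cot(1/√2)`. Printed proof: "`G(u) := ψ(u) +
∫|u − v|ψ(v) dv` has `G'' = ψ'' + 2ψ = 0` on `(−½,½)`, hence is affine there, hence (being even)
constant; `G(0) = cos(1/√2) + (1/√2) sin(1/√2)` and `∫ψ = √2 sin(1/√2)`, so `R(ψ_MT) = G(0)/∫ψ`."
Here the constancy of `G` is obtained by evaluating the inner integral in closed form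
(`AlpogeFurman2026.MTWindow.inner_integral_abs_sub_mul_cos`:
`∫_{−½}^{½} |u − v| cos(kv) dv = −2cos(ku)/k² + sin(k/2)/k + 2cos(k/2)/k²`, at `k = √2`, `k² = 2`),
after which `∫ψ² + ∫ψ·I = G(0)∫ψ` and the division are elementary. This pins `windowConstant`,
`montgomeryTaylorWindow`, `montgomeryTaylorInvConstant` of the statement file against each other in
the kernel (the flat-window value `R(ψ₀) = 4/3` is `windowConstant_one` there).
-/

noncomputable section

namespace Literature.NumberTheory.LFunctions

namespace AlpogeFurman2026.MTWindow

open Set MeasureTheory intervalIntegral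
open scoped Real

/-- Antiderivative of `v ↦ (u − v) cos(kv)`. [folklore] -/
private theorem hasDerivAt_left_piece (u k v : ℝ) (hk : k ≠ 0) :
    HasDerivAt (fun v ↦ (u - v) * Real.sin (k * v) / k - Real.cos (k * v) / k ^ 2)
      ((u - v) * Real.cos (k * v)) v := by
  have hs : HasDerivAt (fun v ↦ Real.sin (k * v)) (Real.cos (k * v) * k) v := by
    simpa [Function.comp_def] using (Real.hasDerivAt_sin (k * v)).comp v ((hasDerivAt_id v).const_mul k)
  have hc : HasDerivAt (fun v ↦ Real.cos (k * v)) (-Real.sin (k * v) * k) v := by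
    simpa [Function.comp_def] using (Real.hasDerivAt_cos (k * v)).comp v ((hasDerivAt_id v).const_mul k)
  have h1 : HasDerivAt (fun v ↦ (u - v) * Real.sin (k * v) / k)
      (((-1) * Real.sin (k * v) + (u - v) * (Real.cos (k * v) * k)) / k) v := by
    have := ((hasDerivAt_id v).const_sub u).mul hs
    simpa using this.div_const k
  have h2 : HasDerivAt (fun v ↦ Real.cos (k * v) / k ^ 2) ((-Real.sin (k * v) * k) / k ^ 2) v :=
    hc.div_const _
  refine (h1.sub h2).congr_deriv ?_
  have hkk : k * k⁻¹ = 1 := mul_inv_cancel₀ hk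
  linear_combination ((u - v) * Real.cos (k * v) + Real.sin (k * v) * k⁻¹) * hkk

/-- Antiderivative of `v ↦ (v − u) cos(kv)`. [folklore] -/
private theorem hasDerivAt_right_piece (u k v : ℝ) (hk : k ≠ 0) :
    HasDerivAt (fun v ↦ (v - u) * Real.sin (k * v) / k + Real.cos (k * v) / k ^ 2)
      ((v - u) * Real.cos (k * v)) v := by
  have hs : HasDerivAt (fun v ↦ Real.sin (k * v)) (Real.cos (k * v) * k) v := by
    simpa [Function.comp_def] using (Real.hasDerivAt_sin (k * v)).comp v ((hasDerivAt_id v).const_mul k)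
  have hc : HasDerivAt (fun v ↦ Real.cos (k * v)) (-Real.sin (k * v) * k) v := by
    simpa [Function.comp_def] using (Real.hasDerivAt_cos (k * v)).comp v ((hasDerivAt_id v).const_mul k)
  have h1 : HasDerivAt (fun v ↦ (v - u) * Real.sin (k * v) / k)
      ((1 * Real.sin (k * v) + (v - u) * (Real.cos (k * v) * k)) / k) v := by
    have := ((hasDerivAt_id v).sub_const u).mul hs
    simpa using this.div_const k
  have h2 : HasDerivAt (fun v ↦ Real.cos (k * v) / k ^ 2) ((-Real.sin (k * v) * k) / k ^ 2) v :=
    hc.div_const _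
  refine (h1.add h2).congr_deriv ?_
  have hkk : k * k⁻¹ = 1 := mul_inv_cancel₀ hk
  linear_combination ((v - u) * Real.cos (k * v) - Real.sin (k * v) * k⁻¹) * hkk

/-- The inner integral in closed form: for `u ∈ [−½,½]` and `k > 0`,
`∫_{−½}^{½} |u − v| cos(kv) dv = −2cos(ku)/k² + sin(k/2)/k + 2cos(k/2)/k²`.
[cite: AlpogeFurman2026, proof of Lemma 5.6 (p. 11)] -/
private theorem inner_integral_abs_sub_mul_cos {u k : ℝ} (hk : 0 < k)
    (hu : u ∈ Icc (-(1 / 2 : ℝ)) (1 / 2)) :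
    ∫ v in (-(1 / 2 : ℝ))..(1 / 2), |u - v| * Real.cos (k * v) =
      -2 * Real.cos (k * u) / k ^ 2 + Real.sin (k / 2) / k + 2 * Real.cos (k / 2) / k ^ 2 := by
  obtain ⟨hu1, hu2⟩ := hu
  have hk0 : k ≠ 0 := hk.ne'
  have hint : ∀ a b : ℝ, IntervalIntegrable (fun v ↦ |u - v| * Real.cos (k * v)) volume a b :=
    fun a b ↦ ((continuous_const.sub continuous_id).abs.mul
      (Real.continuous_cos.comp (continuous_const.mul continuous_id))).intervalIntegrable a b
  rw [← integral_add_adjacent_intervals (hint _ u) (hint u _)]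
  have h1 : ∫ v in (-(1 / 2 : ℝ))..u, |u - v| * Real.cos (k * v) =
      ∫ v in (-(1 / 2 : ℝ))..u, (u - v) * Real.cos (k * v) :=
    integral_congr fun v hv ↦ by
      rw [Set.uIcc_of_le hu1] at hv
      simp only [abs_of_nonneg (show 0 ≤ u - v by linarith [hv.2])]
  have h2 : ∫ v in u..(1 / 2 : ℝ), |u - v| * Real.cos (k * v) =
      ∫ v in u..(1 / 2 : ℝ), (v - u) * Real.cos (k * v) :=
    integral_congr fun v hv ↦ by
      rw [Set.uIcc_of_le hu2] at hv
      rw [abs_of_nonpos (show u - v ≤ 0 by linarith [hv.1])]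
      ring
  rw [h1, h2,
    integral_eq_sub_of_hasDerivAt (fun v _ ↦ hasDerivAt_left_piece u k v hk0)
      (((continuous_const.sub continuous_id).mul
        (Real.continuous_cos.comp (continuous_const.mul continuous_id))).intervalIntegrable _ _),
    integral_eq_sub_of_hasDerivAt (fun v _ ↦ hasDerivAt_right_piece u k v hk0)
      (((continuous_id.sub continuous_const).mul
        (Real.continuous_cos.comp (continuous_const.mul continuous_id))).intervalIntegrable _ _)]
  simp only [sub_self, zero_mul, zero_div, zero_sub, zero_add]
  rw [show k * -(1 / 2 : ℝ) = -(k / 2) by ring, Real.sin_neg, Real.cos_neg,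
    show k * (1 / 2 : ℝ) = k / 2 by ring]
  field_simp
  ring

/-- `∫_{−½}^{½} cos(ku) du = 2 sin(k/2)/k` (`k ≠ 0`). [folklore] -/
private theorem integral_cos_mul {k : ℝ} (hk : k ≠ 0) :
    ∫ u in (-(1 / 2 : ℝ))..(1 / 2), Real.cos (k * u) = 2 * Real.sin (k / 2) / k := by
  have hd : ∀ u ∈ Set.uIcc (-(1 / 2 : ℝ)) (1 / 2), HasDerivAt (fun u ↦ Real.sin (k * u) / k) (Real.cos (k * u)) u := by
    intro u _
    have hs : HasDerivAt (fun v ↦ Real.sin (k * v)) (Real.cos (k * u) * k) u := by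
      simpa [Function.comp_def] using (Real.hasDerivAt_sin (k * u)).comp u ((hasDerivAt_id u).const_mul k)
    refine (hs.div_const k).congr_deriv ?_
    have hkk : k * k⁻¹ = 1 := mul_inv_cancel₀ hk
    linear_combination (Real.cos (k * u)) * hkk
  rw [integral_eq_sub_of_hasDerivAt hd
    ((Real.continuous_cos.comp (continuous_const.mul continuous_id)).intervalIntegrable _ _)]
  rw [show k * -(1 / 2 : ℝ) = -(k / 2) by ring, Real.sin_neg, show k * (1 / 2 : ℝ) = k / 2 by ring]
  field_simp
  ring

/-- `(√2)² = 2`, `√2 > 0`, and `√2/2 = 1/√2`. [folklore] -/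
private theorem sqrt_two_facts :
    Real.sqrt 2 ^ 2 = 2 ∧ 0 < Real.sqrt 2 ∧ Real.sqrt 2 / 2 = 1 / Real.sqrt 2 := by
  have h1 : Real.sqrt 2 ^ 2 = 2 := Real.sq_sqrt (by norm_num)
  have h2 : 0 < Real.sqrt 2 := Real.sqrt_pos.2 (by norm_num)
  refine ⟨h1, h2, ?_⟩
  field_simp
  nlinarith [h1]

end AlpogeFurman2026.MTWindow

open Set MeasureTheory intervalIntegral AlpogeFurman2026.MTWindow in
open scoped Real in
/-- **[AF26] Lemma 5.6, second value, PROVED** (discharge of the claim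
`AlpogeFurman2026_windowConstant_MT`): `R(ψ_MT) = ½ + (1/√2) cot(1/√2) = c_MT⁻¹`.
[cite: AlpogeFurman2026, Lemma 5.6 (p. 11)] -/
theorem AlpogeFurman2026_windowConstant_MT_holds : AlpogeFurman2026_windowConstant_MT := by
  obtain ⟨hsq, hpos, hhalf⟩ := sqrt_two_facts
  set k := Real.sqrt 2 with hk
  have hk0 : k ≠ 0 := hpos.ne'
  -- the constant `G(0)` and the mass `∫ψ`
  set G0 : ℝ := Real.sin (k / 2) / k + 2 * Real.cos (k / 2) / k ^ 2 with hG0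
  have hB : ∫ u in (-(1 / 2 : ℝ))..(1 / 2), montgomeryTaylorWindow u = 2 * Real.sin (k / 2) / k := by
    simp only [montgomeryTaylorWindow]
    exact integral_cos_mul hk0
  -- the double integral, inner part evaluated
  have hC : ∫ u in (-(1 / 2 : ℝ))..(1 / 2), ∫ v in (-(1 / 2 : ℝ))..(1 / 2),
      |u - v| * (montgomeryTaylorWindow u * montgomeryTaylorWindow v) =
      ∫ u in (-(1 / 2 : ℝ))..(1 / 2), Real.cos (k * u) * (-2 * Real.cos (k * u) / k ^ 2 + G0) := by
    refine integral_congr fun u hu ↦ ?_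
    rw [Set.uIcc_of_le (by norm_num)] at hu
    simp only [montgomeryTaylorWindow]
    have : ∫ v in (-(1 / 2 : ℝ))..(1 / 2), |u - v| * (Real.cos (k * u) * Real.cos (k * v)) =
        Real.cos (k * u) * ∫ v in (-(1 / 2 : ℝ))..(1 / 2), |u - v| * Real.cos (k * v) := by
      rw [← intervalIntegral.integral_const_mul]
      refine integral_congr fun v _ ↦ ?_
      ring
    rw [this, inner_integral_abs_sub_mul_cos hpos hu, hG0]
    ring
  have hA : ∫ u in (-(1 / 2 : ℝ))..(1 / 2), montgomeryTaylorWindow u ^ 2 =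
      ∫ u in (-(1 / 2 : ℝ))..(1 / 2), Real.cos (k * u) ^ 2 := by
    simp only [montgomeryTaylorWindow, hk]
  have hcont1 : IntervalIntegrable (fun u ↦ Real.cos (k * u) ^ 2) volume (-(1 / 2 : ℝ)) (1 / 2) :=
    ((Real.continuous_cos.comp (continuous_const.mul continuous_id)).pow 2).intervalIntegrable _ _
  have hcont2 : IntervalIntegrable (fun u ↦ Real.cos (k * u) * (-2 * Real.cos (k * u) / k ^ 2 + G0))
      volume (-(1 / 2 : ℝ)) (1 / 2) := by
    apply Continuous.intervalIntegrable
    fun_prop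
  have hsum : (∫ u in (-(1 / 2 : ℝ))..(1 / 2), Real.cos (k * u) ^ 2) +
      (∫ u in (-(1 / 2 : ℝ))..(1 / 2), Real.cos (k * u) * (-2 * Real.cos (k * u) / k ^ 2 + G0)) =
      G0 * (2 * Real.sin (k / 2) / k) := by
    rw [← intervalIntegral.integral_add hcont1 hcont2, ← integral_cos_mul hk0,
      ← intervalIntegral.integral_const_mul]
    refine integral_congr fun u _ ↦ ?_
    rw [hsq]
    ring
  -- `sin(k/2) > 0`
  have hsin : 0 < Real.sin (k / 2) := by
    apply Real.sin_pos_of_pos_of_lt_pi (by positivity)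
    have : k < 2 := by nlinarith [hsq, hpos]
    linarith [Real.pi_gt_three]
  unfold AlpogeFurman2026_windowConstant_MT windowConstant montgomeryTaylorInvConstant
  rw [hC, hA, hsum, hB]
  rw [← hk, ← hhalf, Real.cot_eq_cos_div_sin, hG0]
  field_simp
  linear_combination (-Real.cos (k / 2)) * hsq

end Literature.NumberTheory.LFunctions

end


/-!
## [AF26] Theorem A: the cumulative form FROM the dyadic form ("The cumulative form follows by summing over dyadic windows", §6, p. 12)

(Appended by cell `rh-columns/lit`, tranche 1; RH-FREE — nothing here bears on the truth of RH.)
`AlpogeFurman2026_simple_critical_of_dyadic` and `AlpogeFurman2026_distinct_of_dyadic`: the dyadic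
claims (i), (ii) imply the cumulative claims, by telescoping over `T, T/2, T/4, …` down to a fixed
window `[T₀, 2T₀)` and absorbing the `O(N(2T₀))` boundary term with `N(T) → ∞`
(`tendsto_zetaZeroCount_atTop_holds`) and the monotonicity of `N` (`zetaZeroCount_mono`). The two
cumulative claims thus carry no content beyond the dyadic ones.
-/

namespace Literature.NumberTheory.LFunctions

namespace AlpogeFurman2026.Dyadic

open Filter

/-- Telescoping over dyadic windows: if `c (N(2T) − N(T)) ≤ A(2T) − A(T)` for all `T ≥ T₀ ≥ 0`,
with `A ≥ 0` and `c ≥ 0`, then `c (N(T) − N(2T₀)) ≤ A(T)` for `T₀ ≤ T ≤ 2^{n+1} T₀`.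
[cite: AlpogeFurman2026, §6 proof of Theorem A (p. 12)] -/
theorem telescope {A : ℝ → ℝ} (hA : ∀ T, 0 ≤ A T) {c : ℝ} (hc : 0 ≤ c) {T₀ : ℝ} (hT₀ : 0 ≤ T₀)
    (h : ∀ T, T₀ ≤ T → c * ((zetaZeroCount (2 * T) : ℝ) - zetaZeroCount T) ≤ A (2 * T) - A T) :
    ∀ n : ℕ, ∀ T, T₀ ≤ T → T ≤ 2 ^ (n + 1) * T₀ →
      c * ((zetaZeroCount T : ℝ) - zetaZeroCount (2 * T₀)) ≤ A T := by
  intro n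
  induction n with
  | zero =>
    intro T _ h2
    have hN : (zetaZeroCount T : ℝ) ≤ zetaZeroCount (2 * T₀) := by
      exact_mod_cast zetaZeroCount_mono (by simpa using h2)
    nlinarith [hA T]
  | succ n ih =>
    intro T h1 h2
    by_cases hle : T ≤ 2 ^ (n + 1) * T₀
    · exact ih T h1 hle
    · push Not at hle
      have h2pow : (2 : ℝ) ≤ 2 ^ (n + 1) := by
        calc (2 : ℝ) = 2 ^ 1 := by norm_num
          _ ≤ 2 ^ (n + 1) := pow_le_pow_right₀ (by norm_num) (by omega)
      have h3 : T₀ ≤ T / 2 := by nlinarith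
      have h4 : T / 2 ≤ 2 ^ (n + 1) * T₀ := by
        rw [pow_succ] at h2
        linarith
      have hih := ih (T / 2) h3 h4
      have hstep := h (T / 2) h3
      rw [show 2 * (T / 2) = T by ring] at hstep
      linarith

/-- From the telescoped bound to the cumulative proportion: if for some `T₀ ≥ 0` and every
`T ≥ T₀` one has `c (N(T) − N(2T₀)) ≤ A(T)`, then for every `δ > 0`, eventually
`(c − δ) N(T) ≤ A(T)` (because `N(T) → ∞`). [cite: AlpogeFurman2026, §6 proof of Theorem A (p. 12)] -/
theorem eventually_of_telescope {A : ℝ → ℝ} {c T₀ : ℝ}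
    (h : ∀ T, T₀ ≤ T → c * ((zetaZeroCount T : ℝ) - zetaZeroCount (2 * T₀)) ≤ A T)
    {δ : ℝ} (hδ : 0 < δ) :
    ∀ᶠ T : ℝ in atTop, (c - δ) * (zetaZeroCount T : ℝ) ≤ A T := by
  have hN : Tendsto zetaZeroCount atTop atTop := tendsto_zetaZeroCount_atTop_holds
  set M : ℕ := ⌈c * (zetaZeroCount (2 * T₀) : ℝ) / δ⌉₊ with hM
  filter_upwards [eventually_ge_atTop T₀, hN.eventually_ge_atTop M] with T hT hMT
  have h1 := h T hT
  have hMT' : c * (zetaZeroCount (2 * T₀) : ℝ) / δ ≤ (zetaZeroCount T : ℝ) :=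
    (Nat.le_ceil _).trans (by exact_mod_cast hMT)
  have h2 : c * (zetaZeroCount (2 * T₀) : ℝ) ≤ δ * (zetaZeroCount T : ℝ) := by
    rw [div_le_iff₀ hδ] at hMT'
    linarith
  nlinarith

end AlpogeFurman2026.Dyadic

open Filter AlpogeFurman2026.Dyadic in
/-- **[AF26] Theorem A (i): dyadic ⇒ cumulative** ("The cumulative form follows by summing over
dyadic windows", §6, p. 12), PROVED: `AlpogeFurman2026_simple_critical_dyadic → AlpogeFurman2026_simple_critical`.
[cite: AlpogeFurman2026, Theorem A and §6 (p. 1, p. 12)] -/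
theorem AlpogeFurman2026_simple_critical_of_dyadic (h : AlpogeFurman2026_simple_critical_dyadic) :
    AlpogeFurman2026_simple_critical := by
  intro ε hε
  by_cases hε' : 2 / 3 ≤ ε
  · refine Filter.Eventually.of_forall fun T ↦ ?_
    have h0 : (0 : ℝ) ≤ simpleCriticalZeroCount T := Nat.cast_nonneg _
    have hN0 : (0 : ℝ) ≤ zetaZeroCount T := Nat.cast_nonneg _
    nlinarith
  · push Not at hε'
    set c : ℝ := 2 / 3 - ε / 2 with hc_def
    have hc : 0 ≤ c := by rw [hc_def]; linarith
    obtain ⟨T₁, hT₁⟩ := Filter.eventually_atTop.1 (h (ε / 2) (by linarith))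
    set T₀ : ℝ := max T₁ 1 with hT₀_def
    have hT₀ : 0 ≤ T₀ := le_trans zero_le_one (le_max_right _ _)
    have hT₀pos : 0 < T₀ := lt_of_lt_of_le zero_lt_one (le_max_right _ _)
    have hstep : ∀ T, T₀ ≤ T → c * ((zetaZeroCount (2 * T) : ℝ) - zetaZeroCount T) ≤
        (simpleCriticalZeroCount (2 * T) : ℝ) - simpleCriticalZeroCount T := fun T hT ↦ by
      have := hT₁ T (le_trans (le_max_left _ _) hT)
      rw [hc_def]; linarith
    have htel := telescope (A := fun T ↦ (simpleCriticalZeroCount T : ℝ)) (fun T ↦ Nat.cast_nonneg _)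
      hc hT₀ hstep
    have hall : ∀ T, T₀ ≤ T → c * ((zetaZeroCount T : ℝ) - zetaZeroCount (2 * T₀)) ≤
        (simpleCriticalZeroCount T : ℝ) := by
      intro T hT
      obtain ⟨n, hn⟩ := pow_unbounded_of_one_lt (T / T₀) (by norm_num : (1 : ℝ) < 2)
      refine htel n T hT ?_
      have : T / T₀ ≤ 2 ^ (n + 1) := hn.le.trans (pow_le_pow_right₀ (by norm_num) (by omega))
      rwa [div_le_iff₀ hT₀pos] at this
    have := eventually_of_telescope (A := fun T ↦ (simpleCriticalZeroCount T : ℝ)) hall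
      (half_pos hε)
    refine this.mono fun T hT ↦ ?_
    have : c - ε / 2 = 2 / 3 - ε := by rw [hc_def]; ring
    rwa [this] at hT

open Filter AlpogeFurman2026.Dyadic in
/-- **[AF26] Theorem A (ii): dyadic ⇒ cumulative**, PROVED:
`AlpogeFurman2026_distinct_dyadic → AlpogeFurman2026_distinct`. [cite: AlpogeFurman2026, Theorem A and §6 (p. 1, p. 12)] -/
theorem AlpogeFurman2026_distinct_of_dyadic (h : AlpogeFurman2026_distinct_dyadic) :
    AlpogeFurman2026_distinct := by
  intro ε hε
  by_cases hε' : 5 / 6 ≤ ε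
  · refine Filter.Eventually.of_forall fun T ↦ ?_
    have h0 : (0 : ℝ) ≤ distinctZeroCount T := Nat.cast_nonneg _
    have hN0 : (0 : ℝ) ≤ zetaZeroCount T := Nat.cast_nonneg _
    nlinarith
  · push Not at hε'
    set c : ℝ := 5 / 6 - ε / 2 with hc_def
    have hc : 0 ≤ c := by rw [hc_def]; linarith
    obtain ⟨T₁, hT₁⟩ := Filter.eventually_atTop.1 (h (ε / 2) (by linarith))
    set T₀ : ℝ := max T₁ 1 with hT₀_def
    have hT₀ : 0 ≤ T₀ := le_trans zero_le_one (le_max_right _ _)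
    have hT₀pos : 0 < T₀ := lt_of_lt_of_le zero_lt_one (le_max_right _ _)
    have hstep : ∀ T, T₀ ≤ T → c * ((zetaZeroCount (2 * T) : ℝ) - zetaZeroCount T) ≤
        (distinctZeroCount (2 * T) : ℝ) - distinctZeroCount T := fun T hT ↦ by
      have := hT₁ T (le_trans (le_max_left _ _) hT)
      rw [hc_def]; linarith
    have htel := telescope (A := fun T ↦ (distinctZeroCount T : ℝ)) (fun T ↦ Nat.cast_nonneg _)
      hc hT₀ hstep
    have hall : ∀ T, T₀ ≤ T → c * ((zetaZeroCount T : ℝ) - zetaZeroCount (2 * T₀)) ≤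
        (distinctZeroCount T : ℝ) := by
      intro T hT
      obtain ⟨n, hn⟩ := pow_unbounded_of_one_lt (T / T₀) (by norm_num : (1 : ℝ) < 2)
      refine htel n T hT ?_
      have : T / T₀ ≤ 2 ^ (n + 1) := hn.le.trans (pow_le_pow_right₀ (by norm_num) (by omega))
      rwa [div_le_iff₀ hT₀pos] at this
    have := eventually_of_telescope (A := fun T ↦ (distinctZeroCount T : ℝ)) hall
      (half_pos hε)
    refine this.mono fun T hT ↦ ?_
    have : c - ε / 2 = 5 / 6 - ε := by rw [hc_def]; ring
    rwa [this] at hT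

end Literature.NumberTheory.LFunctions
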